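import Mathlib
import HarnessLib
import Summits.AtomisticToContinuum.BoseEinsteinCondensation.Statement
import Summits.AtomisticToContinuum.BoseEinsteinCondensation.Theses.BECLatticeDepthHomotopy
import Literature.MathematicalPhysics.QuantumManyBody.PeriodicBoseGas
import Literature.MathematicalPhysics.QuantumLattice.XYOrder

/-!
# Birth skeleton (BC3) for crux `DeepLatticeFloor` — route BECLatticeDepthHomotopy
(item stmt-AtomisticToContinuum-12406)

The route's own foreseen split (`DeepLatticeFloor ⇐ TightBindingLimit → CanonicalKLS → glue`),
typed over existing declarations, with the lattice half cut once more along the refuter's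
recorded gap (tracial vs canonical KLS):

* `stub_tightBindingLimit` (XL, load-bearing; continuum → lattice at FIXED volume): for a
  repulsive finite-range `v` there is `ρ₁(v) > 0` such that for every `m ≥ 1` whose spin-½ XY
  model on the even torus `(ℤ/2m)³` has a unique ground state lying in the sector `S³_tot = 0`
  (hypothesis), and every `0 < ρ < ρ₁`, the deep-lattice limit of the mode-free ground-state
  condensate number dominates the lattice order parameter tested against the constant mode:
  `liminf_{c→∞} Λ(c) ≥ V⁻¹ Σ_{x,y∈(ℤ/2m)³} ⟨S¹_x S¹_y + S²_x S²_y⟩_GS`, `V = 8m³`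
  (tight-binding / hard-core limit onto the lowest Wannier band: `λ_max(γ) ≥ V⁻¹Σ_{x,y} γ(x,y)
  = V⁻¹⟨S⁺_tot S⁻_tot⟩ = V⁻¹⟨(S¹_tot)² + (S²_tot)²⟩` at `S³_tot = 0`; the hypothesis identifies the
  canonical half-filled ground state with the tree's TRACIAL ground-state functional).
* `stub_halfFillingGround` (M/L; finite lattice, every `m ≥ 1`): the spin-½ ferromagnetic XY model
  on `(ℤ/2m)³` has a unique ground state and it lies in the sector `S³_tot = 0` (Perron–Frobenius in
  each sector + `E₀(M)` minimal at `M = 0`; Lieb–Mattis-type ordering; ED evidence on small tori is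
  attached to the item: charging gaps 1.056 / 0.306 / 0.502 t).
* `stub_klsFloor` (S; the anchor in usable form): Kennedy–Lieb–Shastry long-range order for
  `d = 3`, `S = ½` as an eventual quadratic lower bound `c₁ V² ≤ Σ_{x,y} ⟨S¹_x S¹_y + S²_x S²_y⟩_GS`
  along even tori (tree: `kennedy_lieb_shastry_xy_ground_holds`, `hasEvenTorusLRO_iff`,
  `card_halfOpenBox`; what remains is the extraction of an eventual bound from `0 < liminf`).
* `DeepLatticeFloor_of : StubsImplyDeepLatticeFloor` (= `stub₁-sig → stub₂-sig → stub₃-sig →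
  DeepLatticeFloor`, a named Prop): the composition, PROVED sorry-free (filter logic + `c₀ := 2 c₁`,
  since `V⁻¹ · c₁ V² = c₁ V = 2 c₁ N` at `N = 4m³ = V/2`; axioms propext / Classical.choice / Quot.sound).
* `DeepLatticeFloor_skeleton : DeepLatticeFloor` — the A12 skeleton theorem: concludes the crux BY NAME with
  no hypotheses, `:= DeepLatticeFloor_of stub₁ stub₂ stub₃`, so `sorryAx` enters only through the three
  declared stubs (the implication is wrapped in the named Prop so that exactly one theorem of this file
  has the crux as its conclusion head, as `#h21_check_skeleton` requires).
-/

namespace Summit.AtomisticToContinuum.BoseEinsteinCondensation.Theses.BECLatticeDepthHomotopy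

open scoped BigOperators Classical Matrix
open Filter Set Function

/-- stub 1 (tight-binding limit, continuum → lattice at fixed volume; XL, load-bearing). -/
theorem stub_tightBindingLimit : ∀ v : ℝ → ENNReal, Literature.MathematicalPhysics.QuantumManyBody.BoseGas.IsRepulsiveFiniteRange v → ∃ ρ₁ : ℝ, 0 < ρ₁ ∧ ∀ m : ℕ, 1 ≤ m → (∀ [NeZero (2 * m)], Module.finrank ℂ ↥((Literature.MathematicalPhysics.QuantumLattice.xyTorus 3 (2 * m) 1).groundSpace) = 1 ∧ (Literature.MathematicalPhysics.QuantumLattice.xyTorus 3 (2 * m) 1).groundSpace ≤ LinearMap.ker (Matrix.toLin' (Literature.MathematicalPhysics.QuantumLattice.totalSpin (Λ := Literature.Probability.LatticeModels.TorusSite 3 (2 * m)) 1 2))) → ∀ ρ : ℝ, 0 < ρ → ρ < ρ₁ → (let N : ℕ := 4 * m ^ 3; let L : ℝ := Literature.MathematicalPhysics.QuantumManyBody.BoseGas.sideLength ρ N; let E : ℝ → Literature.MathematicalPhysics.QuantumManyBody.BoseGas.PeriodicTrialState N L → ENNReal := fun c Ψ => Literature.MathematicalPhysics.QuantumManyBody.BoseGas.periodicEnergy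 v Ψ + ENNReal.ofReal c * ∫⁻ X in Literature.MathematicalPhysics.QuantumManyBody.BoseGas.cellN N L, ENNReal.ofReal (∑ i, ∑ k : Fin 3, Real.sin (Real.pi * (X i) k * (2 * (m : ℝ)) / L) ^ 2) * (‖Ψ.ψ X‖₊ : ENNReal) ^ 2; let Λ : ℝ → ENNReal := fun c => ⨆ (δ : ENNReal) (_ : 0 < δ), ⨅ (Ψ : Literature.MathematicalPhysics.QuantumManyBody.BoseGas.PeriodicTrialState N L) (_ : E c Ψ ≤ (⨅ Φ : Literature.MathematicalPhysics.QuantumManyBody.BoseGas.PeriodicTrialState N L, E c Φ) + δ), Literature.MathematicalPhysics.QuantumManyBody.BoseGas.maxOccupation N ((Literature.MathematicalPhysics.QuantumManyBody.BoseGas.cellN N L).indicator Ψ.ψ); ENNReal.ofReal (((8 * m ^ 3 : ℕ) : ℝ)⁻¹ * (∑ x ∈ Literature.Probability.LatticeModels.halfOpenBox 3 (2 * m), ∑ y ∈ Literature.Probability.LatticeModels.halfOpenBox 3 (2 * m), Literature.MathematicalPhysics.QuantumLattice.torusPullback (fun L x y => Literature.MathematicalPhysics.QuantumLattice.groundStateXYCorrTorus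 (d := 3) L 1 x y) (2 * m) x y)) ≤ Filter.liminf Λ Filter.atTop) := by
  sorry

/-- stub 2 (unique half-filled ground state of the spin-½ XY model on `(ℤ/2m)³`, every `m ≥ 1`). -/
theorem stub_halfFillingGround : ∀ m : ℕ, 1 ≤ m → (∀ [NeZero (2 * m)], Module.finrank ℂ ↥((Literature.MathematicalPhysics.QuantumLattice.xyTorus 3 (2 * m) 1).groundSpace) = 1 ∧ (Literature.MathematicalPhysics.QuantumLattice.xyTorus 3 (2 * m) 1).groundSpace ≤ LinearMap.ker (Matrix.toLin' (Literature.MathematicalPhysics.QuantumLattice.totalSpin (Λ := Literature.Probability.LatticeModels.TorusSite 3 (2 * m)) 1 2))) := by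
  sorry

/-- stub 3 (Kennedy–Lieb–Shastry floor, `d = 3`, `S = ½`, eventual quadratic form). -/
theorem stub_klsFloor : ∃ c₁ : ℝ, 0 < c₁ ∧ ∀ᶠ m : ℕ in Filter.atTop, c₁ * ((8 * m ^ 3 : ℕ) : ℝ) ^ 2 ≤ ∑ x ∈ Literature.Probability.LatticeModels.halfOpenBox 3 (2 * m), ∑ y ∈ Literature.Probability.LatticeModels.halfOpenBox 3 (2 * m), Literature.MathematicalPhysics.QuantumLattice.torusPullback (fun L x y => Literature.MathematicalPhysics.QuantumLattice.groundStateXYCorrTorus (d := 3) L 1 x y) (2 * m) x y := by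
  sorry

/-- The skeleton implication `stub₁-sig → stub₂-sig → stub₃-sig → DeepLatticeFloor` as a NAMED
proposition (kept reducible), so that the only theorem whose conclusion head is the crux is
`DeepLatticeFloor_skeleton` below. -/
abbrev StubsImplyDeepLatticeFloor : Prop :=
  (∀ v : ℝ → ENNReal, Literature.MathematicalPhysics.QuantumManyBody.BoseGas.IsRepulsiveFiniteRange v → ∃ ρ₁ : ℝ, 0 < ρ₁ ∧ ∀ m : ℕ, 1 ≤ m → (∀ [NeZero (2 * m)], Module.finrank ℂ ↥((Literature.MathematicalPhysics.QuantumLattice.xyTorus 3 (2 * m) 1).groundSpace) = 1 ∧ (Literature.MathematicalPhysics.QuantumLattice.xyTorus 3 (2 * m) 1).groundSpace ≤ LinearMap.ker (Matrix.toLin' (Literature.MathematicalPhysics.QuantumLattice.totalSpin (Λ := Literature.Probability.LatticeModels.TorusSite 3 (2 * m)) 1 2))) → ∀ ρ : ℝ, 0 < ρ → ρ < ρ₁ → (let N : ℕ := 4 * m ^ 3; let L : ℝ := Literature.MathematicalPhysics.QuantumManyBody.BoseGas.sideLength ρ N; let E : ℝ → Literature.MathematicalPhysics.QuantumManyBody.BoseGas.PeriodicTrialState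 N L → ENNReal := fun c Ψ => Literature.MathematicalPhysics.QuantumManyBody.BoseGas.periodicEnergy v Ψ + ENNReal.ofReal c * ∫⁻ X in Literature.MathematicalPhysics.QuantumManyBody.BoseGas.cellN N L, ENNReal.ofReal (∑ i, ∑ k : Fin 3, Real.sin (Real.pi * (X i) k * (2 * (m : ℝ)) / L) ^ 2) * (‖Ψ.ψ X‖₊ : ENNReal) ^ 2; let Λ : ℝ → ENNReal := fun c => ⨆ (δ : ENNReal) (_ : 0 < δ), ⨅ (Ψ : Literature.MathematicalPhysics.QuantumManyBody.BoseGas.PeriodicTrialState N L) (_ : E c Ψ ≤ (⨅ Φ : Literature.MathematicalPhysics.QuantumManyBody.BoseGas.PeriodicTrialState N L, E c Φ) + δ), Literature.MathematicalPhysics.QuantumManyBody.BoseGas.maxOccupation N ((Literature.MathematicalPhysics.QuantumManyBody.BoseGas.cellN N L).indicator Ψ.ψ); ENNReal.ofReal (((8 * m ^ 3 : ℕ) : ℝ)⁻¹ * (∑ x ∈ Literature.Probability.LatticeModels.halfOpenBox 3 (2 * m), ∑ y ∈ Literature.Probability.LatticeModels.halfOpenBox 3 (2 * m), Literature.MathematicalPhysics.QuantumLattice.torusPullback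 (fun L x y => Literature.MathematicalPhysics.QuantumLattice.groundStateXYCorrTorus (d := 3) L 1 x y) (2 * m) x y)) ≤ Filter.liminf Λ Filter.atTop)) → (∀ m : ℕ, 1 ≤ m → (∀ [NeZero (2 * m)], Module.finrank ℂ ↥((Literature.MathematicalPhysics.QuantumLattice.xyTorus 3 (2 * m) 1).groundSpace) = 1 ∧ (Literature.MathematicalPhysics.QuantumLattice.xyTorus 3 (2 * m) 1).groundSpace ≤ LinearMap.ker (Matrix.toLin' (Literature.MathematicalPhysics.QuantumLattice.totalSpin (Λ := Literature.Probability.LatticeModels.TorusSite 3 (2 * m)) 1 2)))) → (∃ c₁ : ℝ, 0 < c₁ ∧ ∀ᶠ m : ℕ in Filter.atTop, c₁ * ((8 * m ^ 3 : ℕ) : ℝ) ^ 2 ≤ ∑ x ∈ Literature.Probability.LatticeModels.halfOpenBox 3 (2 * m), ∑ y ∈ Literature.Probability.LatticeModels.halfOpenBox 3 (2 * m), Literature.MathematicalPhysics.QuantumLattice.torusPullback (fun L x y => Literature.MathematicalPhysics.QuantumLattice.groundStateXYCorrTorus (d := 3) L 1 x y) (2 * m) x y) → DeepLatticeFloor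

/-- Assembly (real proof, no sorry): the three stub STATEMENTS imply the crux `DeepLatticeFloor`
(filter logic, `c₀ = 2c₁`). -/
theorem DeepLatticeFloor_of : StubsImplyDeepLatticeFloor := by
  intro h1 h2 h3 v hv
  obtain ⟨ρ₁, hρ₁, H1⟩ := h1 v hv
  obtain ⟨c₁, hc₁, H3⟩ := h3
  refine ⟨ρ₁, 2 * c₁, hρ₁, by positivity, ?_⟩
  filter_upwards [H3, Filter.eventually_ge_atTop 1] with m hm3 hm1
  intro ρ hρ hρ₁
  have key := H1 m hm1 (h2 m hm1) ρ hρ hρ₁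
  dsimp only at key ⊢
  refine le_trans (ENNReal.ofReal_le_ofReal ?_) key
  have hm0 : 0 < m := hm1
  have hV : (0 : ℝ) < ((8 * m ^ 3 : ℕ) : ℝ) := by positivity
  calc 2 * c₁ * ((4 * m ^ 3 : ℕ) : ℝ)
      = ((8 * m ^ 3 : ℕ) : ℝ)⁻¹ * (c₁ * ((8 * m ^ 3 : ℕ) : ℝ) ^ 2) := by
        push_cast
        field_simp
        ring
    _ ≤ _ := by gcongr

/-- A12 skeleton theorem: the crux BY NAME from the three declared stubs (depends on `sorryAx` only
through `stub_tightBindingLimit`, `stub_halfFillingGround`, `stub_klsFloor`). -/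
theorem DeepLatticeFloor_skeleton : DeepLatticeFloor :=
  DeepLatticeFloor_of stub_tightBindingLimit stub_halfFillingGround stub_klsFloor

end Summit.AtomisticToContinuum.BoseEinsteinCondensation.Theses.BECLatticeDepthHomotopy
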